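import Literature.RingTheory.FormalGroups.FormalOModuleLawLift
import HarnessLib

/-!
# Formal `𝒪`-module laws, unbundled (`Prop`-valued structure on a law and an action) and their lifting along surjections
# ([Drinfeld 1974] §1 Def. and Prop. 1.4; [Hazewinkel 1978] §21.1, §21.5)

Topic `Literature/RingTheory/FormalGroups`; namespace `Literature.RingTheory.FormalGroups`.  One definition (the `Prop`-valued
structure `IsFormalOModuleLaw 𝒪 F ρ` on a Mathlib `FormalGroup` `F` and a map `ρ : 𝒪 → FormalGroupHom F F`) + fully proved
theorems; no named fact, no instance, no notation, no `sorry`.  Cell `hodgecm-mathlib`, P6 «MOD programme», sub-line P6d: the line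
`Cruxes/HLiu418/Lines/F0_P6d_LubinTateFormalModuli.lean` states its letter `FormalOModuleLiftsAlongSurjection 𝒪 p` over exactly this
`Prop`-structure (fields `isComm`, `coeff_one`, `map_one`, `map_zero`, `map_add`, `map_mul`, token for token); this file provides
it on the Literature side together with the bridge to the bundled ★ `FormalOModuleLaw` and THE LIFTING THEOREM in this currency
(`IsFormalOModuleLaw.exists_lift_of_surjective`, from ★ `FormalOModuleLaw.exists_lift_of_surjective`).
-/

noncomputable section

namespace Literature.RingTheory.FormalGroups

universe u v w

/-- **A formal `𝒪`-module STRUCTURE on a commutative law `F` over an `𝒪`-algebra `A`** (`Prop`-valued, unbundled form of ★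
`FormalOModuleLaw`): a map `ρ : 𝒪 → End F`, `a ↦ [a]_F` (★ `FormalGroupHom F F`), with linear term `algebraMap 𝒪 A a`,
`[1]_F = X`, `[0]_F = 0`, `[a+b]_F = F([a]_F, [b]_F)`, `[ab]_F = [a]_F ∘ [b]_F`. [cite: Drinfeld1974, §1 Def.] [cite: Hazewinkel1978, §21.1 Def. (21.1.1)] -/
structure IsFormalOModuleLaw (𝒪 : Type*) {A : Type*} [CommRing 𝒪] [CommRing A] [Algebra 𝒪 A]
    (F : FormalGroup A) (ρ : 𝒪 → FormalGroupHom F F) : Prop where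
  /-- `F` is commutative. -/
  isComm : F.IsComm
  /-- `[a]_F(X) ≡ a·X (mod X²)`. -/
  coeff_one : ∀ a, PowerSeries.coeff 1 (ρ a).toPowerSeries = algebraMap 𝒪 A a
  /-- `[1]_F = X`. -/
  map_one : ρ 1 = FormalGroupHom.id F
  /-- `[0]_F = 0`. -/
  map_zero : (ρ 0).toPowerSeries = 0
  /-- `[a + b]_F = F([a]_F, [b]_F)`. -/
  map_add : ∀ a b, (ρ (a + b)).toPowerSeries =
    F.toPowerSeries.subst ![((ρ a).toPowerSeries : MvPowerSeries Unit A), (ρ b).toPowerSeries]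
  /-- `[a * b]_F = [a]_F ∘ [b]_F`. -/
  map_mul : ∀ a b, ρ (a * b) = (ρ a).comp (ρ b)

variable {𝒪 : Type u} [CommRing 𝒪] {A : Type v} [CommRing A] [Algebra 𝒪 A]

/-- Bundling: an unbundled formal `𝒪`-module structure gives a ★ `FormalOModuleLaw`. [cite: Hazewinkel1978, §21.1 Def. (21.1.1)] -/
def IsFormalOModuleLaw.toFormalOModuleLaw {F : FormalGroup A} {ρ : 𝒪 → FormalGroupHom F F} (h : IsFormalOModuleLaw 𝒪 F ρ) :
    FormalOModuleLaw 𝒪 A where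
  toFormalGroup := F
  isComm := h.isComm
  act := ρ
  coeff_one_act := h.coeff_one
  act_zero := h.map_zero
  act_one := by rw [h.map_one]; rfl
  act_add := h.map_add
  act_mul a b := by rw [h.map_mul]; rfl

/-- The bundled law has law `F`. [cite: Hazewinkel1978, §21.1 Def. (21.1.1)] -/
@[simp] theorem IsFormalOModuleLaw.toFormalOModuleLaw_toFormalGroup {F : FormalGroup A} {ρ : 𝒪 → FormalGroupHom F F}
    (h : IsFormalOModuleLaw 𝒪 F ρ) : h.toFormalOModuleLaw.toFormalGroup = F := rfl

/-- The bundled law has action `ρ`. [cite: Hazewinkel1978, §21.1 Def. (21.1.1)] -/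
@[simp] theorem IsFormalOModuleLaw.toFormalOModuleLaw_act {F : FormalGroup A} {ρ : 𝒪 → FormalGroupHom F F}
    (h : IsFormalOModuleLaw 𝒪 F ρ) : h.toFormalOModuleLaw.act = ρ := rfl

/-- Unbundling: a ★ `FormalOModuleLaw` satisfies `IsFormalOModuleLaw` on its law and action. [cite: Hazewinkel1978, §21.1 Def. (21.1.1)] -/
theorem FormalOModuleLaw.isFormalOModuleLaw (M : FormalOModuleLaw 𝒪 A) : IsFormalOModuleLaw 𝒪 M.toFormalGroup M.act where
  isComm := M.isComm
  coeff_one := M.coeff_one_act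
  map_one := M.act_one'
  map_zero := M.act_zero
  map_add := M.act_add
  map_mul := M.act_mul'

/-- **Formal `𝒪`-module laws lift along surjections, unbundled form** (`𝒪` a discrete valuation ring with finite residue field
of characteristic `p`; `π : A′ ↠ A` a surjective `𝒪`-algebra map): for every `(F, ρ)` with `IsFormalOModuleLaw 𝒪 F ρ` over `A`
there is `(F′, ρ′)` over `A′` with `IsFormalOModuleLaw 𝒪 F′ ρ′`, `F′.map π = F` and `π_* [a]_{F′} = [a]_F` for all `a`.
[cite: Drinfeld1974, §1 Prop. 1.4] [cite: Hazewinkel1978, §21.5] -/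
theorem IsFormalOModuleLaw.exists_lift_of_surjective [IsDomain 𝒪] [IsDiscreteValuationRing 𝒪]
    [Finite (IsLocalRing.ResidueField 𝒪)] (p : ℕ) [Fact p.Prime] [CharP (IsLocalRing.ResidueField 𝒪) p]
    {A' : Type w} [CommRing A'] [Algebra 𝒪 A'] (π : A' →ₐ[𝒪] A) (hπ : Function.Surjective π)
    {F : FormalGroup A} {ρ : 𝒪 → FormalGroupHom F F} (h : IsFormalOModuleLaw 𝒪 F ρ) :
    ∃ (F' : FormalGroup A') (ρ' : 𝒪 → FormalGroupHom F' F'), IsFormalOModuleLaw 𝒪 F' ρ' ∧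
      F'.map π.toRingHom = F ∧ ∀ a, PowerSeries.map π.toRingHom (ρ' a).toPowerSeries = (ρ a).toPowerSeries := by
  obtain ⟨M', hF, hρ⟩ := h.toFormalOModuleLaw.exists_lift_of_surjective p π hπ
  refine ⟨M'.toFormalGroup, M'.act, M'.isFormalOModuleLaw, FormalGroup.ext ?_, fun a => ?_⟩
  · rw [FormalGroup.map_toPowerSeries]; exact hF
  · exact hρ a

end Literature.RingTheory.FormalGroups
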